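import Summits.BirchSwinnertonDyer.BirchSwinnertonDyer.Theses.SignedBaseChange
import Literature.NumberTheory.EllipticCurves.WZhang2014.KolyvaginNonvanishing
import Literature.NumberTheory.EllipticCurves.AnticyclotomicSignedHeegnerClasses
import HarnessLib

/-!
# Sketch — First lemmas of the crux idea cards filed by bsd-idea-14 (lens=complete)

* `RatEulerSystemSS` — card `ratlift` (crux item stmt-BirchSwinnertonDyer-20728): the transfer target
  C⁺ = the RATIONAL two-variable Euler-system inclusion at split supersingular `p` (= registered stub
  `stub_ratEulerSystemSS` of `Lines/ratlift.lean`, sha16 686b0aa0de5680e2).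
* `KolyvaginNonvanishingSS` — card `primkoly` (crux item stmt-BirchSwinnertonDyer-20727): Kolyvagin's
  non-vanishing conjecture at a good SUPERSINGULAR prime `p ≥ 5`, `N⁻ = 1`, in the tree's Zhang-2014
  vocabulary (the shape of `WZhang2014.thm11_exists_kolyvaginClass_one_ne_zero` with «ordinary + ♠»
  replaced by «`a_p = 0` + at least one `ℓ ∥ N`», conclusion `c_M(n) ≠ 0` for some `1 ≤ M ≤ M(n)` —
  N. Sweeting, arXiv:2012.11771 Thm. 1.1, even case).
Nothing is asserted (two `def … : Prop`). BSD is not proved by this seat.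
-/

set_option autoImplicit false

namespace Summit.BirchSwinnertonDyer.BirchSwinnertonDyer.Cruxes.IdeaSketches

open Summit.BirchSwinnertonDyer.BirchSwinnertonDyer.Theses.SignedBaseChange
open Literature.NumberTheory.EllipticCurves Literature.NumberTheory.EllipticCurves.Module
open Literature.NumberTheory.EllipticCurves.ModularForms

/-- First lemma of card `ratlift` (= C⁺, the transfer target; registered stub `stub_ratEulerSystemSS`). -/
def RatEulerSystemSS : Prop :=
  SignedTwoVariableInputs → Literature.NumberTheory.EllipticCurves.ModularForms.nonempty_modularParametrizationData → ∀ (W : WeierstrassCurve ℚ) [W.IsElliptic] [W.IsGloballyMinimal] (p : ℕ) [Fact p.Prime], 5 ≤ p → W.HasGoodReductionAtPrime p → W.frobeniusTrace p = 0 → Literature.NumberTheory.EllipticCurves.Rank1Residual.Surj W p → ∀ (K : Type) [Field K] [NumberField K] (ι : PadicAlgCl p ≃+* ℂ) (v vbar : IsDedekindDomain.HeightOneSpectrum (NumberField.RingOfIntegers K)) (κ₁ κ₂ : Literature.NumberTheory.EllipticCurves.ZpExtension K p) (γ₁ γ₂ : Field.absoluteGaloisGroup K) [Fact (Literature.NumberTheory.EllipticCurves.ZpExtension.IsTopGeneratorPair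 κ₁ κ₂ γ₁ γ₂)] [NeZero (NumberField.discr K).natAbs] (N : ℕ) [NeZero N] (f : CuspForm (CongruenceSubgroup.Gamma0 N) 2), Literature.NumberTheory.EllipticCurves.ModularForms.IsNewformOf W f → (N : ℤ) = W.conductorNorm ℤ → Literature.NumberTheory.EllipticCurves.IsImaginaryQuadratic K → ((Ideal.span {(p : ℤ)}).primesOver (NumberField.RingOfIntegers K)).ncard = 2 → ((p : ℕ) : NumberField.RingOfIntegers K) ∈ v.asIdeal → ((p : ℕ) : NumberField.RingOfIntegers K) ∈ vbar.asIdeal → vbar ≠ v → (∀ (w : NumberField.InfinitePlace K) (k : NumberField.RingOfIntegers K), k ∈ v.asIdeal ↔ ‖ι.symm (w.embedding (k : K))‖ < 1) → IsCoprime (N : ℤ) (NumberField.discr K) → (∀ ℓ : ℕ, ℓ.Prime → ℓ ∣ N → ((Ideal.span {(ℓ : ℤ)}).primesOver (NumberField.RingOfIntegers K)).ncard = 2) → Odd (NumberField.discr K) → NumberField.discr K ≠ -3 → κ₁.IsCyclotomic → κ₂.IsAnticyclotomic → ∀ (Ω δ : ℂ) (Ωp : (Literature.NumberTheory.EllipticCurves.unrIntegers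 p)ˣ) (LK G : PowerSeries (PowerSeries (PadicComplexInt p))), Ω ≠ 0 → (δ ^ 2 = (NumberField.discr K : ℂ) ∨ δ ^ 2 = -(NumberField.discr K : ℂ)) → Literature.NumberTheory.EllipticCurves.IsKatzMeasure₂ ι v vbar ∅ κ₁ κ₂ γ₁⁻¹ γ₂⁻¹ 1 Ω δ ((Ωp : Literature.NumberTheory.EllipticCurves.unrIntegers p) : PadicComplex p) LK → Literature.NumberTheory.EllipticCurves.IsGreenbergLFunctionAnyRoot₂ ι v vbar κ₁ κ₂ γ₁⁻¹ γ₂⁻¹ f (NumberField.discr K).natAbs (NumberField.classNumber K) LK G → ∀ J : ℤ_[p] →+* PadicComplexInt p, (∀ x : ℤ_[p], ((J x : PadicComplexInt p) : PadicComplex p) = ((x : ℚ_[p]) : PadicComplex p)) → ∃ a : ℕ, Ideal.span {((p : ℕ) : PowerSeries (PowerSeries (PadicComplexInt p))) ^ a * G} ≤ (WeierstrassCurve.XGr₂.charIdeal (W.baseChange K) p κ₁ κ₂ vbar γ₁ γ₂).map (Literature.NumberTheory.EllipticCurves.IwasawaAlgebra₂.toUnr₂ p J)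

/-- First lemma of card `primkoly`: Kolyvagin non-vanishing at good supersingular `p ≥ 5`, `N⁻ = 1`,
under «some `ℓ ∥ N`» (Sweeting 2020, Thm. 1.1 shape; the tree types only Zhang's ordinary Thm. 1.1). -/
def KolyvaginNonvanishingSS : Prop :=
  ∀ (W : WeierstrassCurve ℚ) [W.IsElliptic] [W.IsGloballyMinimal] (p : ℕ) [hp : Fact p.Prime],
    5 ≤ p → W.HasGoodReductionAtPrime p → W.frobeniusTrace p = 0 →
    W.HasSurjectiveModNGaloisRep p →
    -- Sweeting's hypothesis «at least one ℓ ∥ N» (no ramification condition at supersingular p)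
    (∃ (ℓ : ℕ) (_ : Fact ℓ.Prime), W.HasMultiplicativeReductionAtPrime ℓ) →
    ∀ (K : Type) [Field K] [NumberField K], IsImaginaryQuadratic K →
      ¬ ((p : ℤ) ∣ NumberField.discr K) →
      IsCoprime (NumberField.discr K) ((W.conductorNorm ℤ : ℕ) : ℤ) →
      ∀ [NeZero (W.conductorNorm ℤ)], SatisfiesHeegnerHypothesis (W.conductorNorm ℤ) K →
      ∃ (Dt : ModularParametrizationData W (W.conductorNorm ℤ)) (β : ℤ) (ι : K →+* ℂ) (n M : ℕ)
        (d : KolyvaginHeegnerData Dt β ι n),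
        KolyvaginDescent.KolSupp (Zhang2014.IsKolyvaginPrime (W.conductorNorm ℤ) W K p) n ∧
          1 ≤ M ∧ (M : ℕ∞) ≤ Zhang2014.levelIndex W p n ∧ d.kolyvaginClass hp.out M ≠ 0

/-- Transfer target C⁺ of card `primkoly` (typed on the tree's SIGNED carriers of
`AnticyclotomicSignedHeegnerClasses.lean`): the EISENSTEIN direction of the signed Heegner point main
conjecture (Castella–Wan 2024 Conj. 4.8) UP TO A POWER OF `p` — `(p^k) · char(X_{ε,Λ-tors}) ⊆
char(Sel_ε(K,𝐓^ac)/Λ^ac z)²` for the `ε`-signed Heegner class `z` — in the binder shape of the tree's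
Howard-direction fact `AcSigned.castellaWan2024_thmA5_signedSelmer_rank_one_dvd_sq`, WITHOUT
`Squarefree N` (surjectivity of `ρ̄_{E,p}` is assumed instead, as in the crux). The card's K1 ∧ K2
(P-wise non-triviality of the signed Kolyvagin system + Kim's Thm 7.7 ported to `±`) prove exactly this;
K3 (Castella–Wan Thm. 6.8 + `μ(L_p^BDP) = 0`) turns it into bdpline's `stub_bdpLowerHalfExistsSS`. -/
def SignedHPMCEisensteinUpToP : Prop :=
  ∀ (N : ℕ) [NeZero N] (W : WeierstrassCurve ℚ) [W.IsGloballyMinimal] (K : Type) [Field K]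
    [NumberField K] (p : ℕ) [Fact p.Prime] (κ : ZpExtension K p)
    (𝔭 𝔭' : IsDedekindDomain.HeightOneSpectrum (NumberField.RingOfIntegers K))
    (jbar : AlgebraicClosure K →+* ℂ) (_ : AcSigned.Setting W K p κ 𝔭 𝔭'),
    (W.conductorNorm ℤ : ℕ) = N → SatisfiesHeegnerHypothesis N K → 3 < p →
    W.HasSurjectiveModNGaloisRep p →
    ∀ (γ : Field.absoluteGaloisGroup K) (hγ : κ.IsTopGenerator γ)
      (F : HeegnerFamily N W K κ jbar), F.IsTraceCoherentApZero → ∀ (ε : ℤˣ)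
      (z : AcSigned.selmerLambdaAdic (W.baseChange K) p κ γ (fun _ ↦ .sgn ε)),
      AcSigned.IsSignedHeegnerClass p κ γ F ε z.1 →
      ∃ k : ℕ, Ideal.span {((p : ℕ) : IwasawaAlgebra p) ^ k} *
          AcSigned.X.torsionCharIdeal (W.baseChange K) p κ ∅ (fun _ ↦ .sgn ε) hγ ≤
        AcSigned.signedHeegnerCharIdeal hγ ε z ^ 2

end Summit.BirchSwinnertonDyer.BirchSwinnertonDyer.Cruxes.IdeaSketches
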